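import Literature.Topology.FourManifolds.TrisectionsSectorNormalForm
import HarnessLib

/-!
# Making the corner coefficient of a sector presentation constant near a point of the central
# surface

Topic `Literature/Topology/FourManifolds`; infrastructure for the fact seat
`provefact-Literature.Topology.FourManifolds.exists-14560f9fc8` (named fact (c′)
`Literature.Topology.FourManifolds.exists_stabilized_gkTrisection`, Gay–Kirby 2016, Def. 8 and
Lemma 10).  Everything in this file is **proved**; no definitions, no named facts.

A sector in normal form (`SectorNormalForm S F u v ρ U O c`, `TrisectionsSectorNormalForm.lean`)
is presented near the central surface `F` by an ambient function of corner form
`G = 1 - 2uv · κ` with `κ > 0` constant along the normal retraction `ρ`.  The implant of the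
stabilisation surgery (`TrisectionsImplantModel.lean`) replaces `(u, v)` by `(ũ, ṽ)` inside a
small box around a point `x ∈ F` and analyses the critical points of `ũ ṽ`; for this the
coefficient `κ` must be **constant** in the box.

**Theorem (`SectorNormalForm.exists_morse_const`).**  *For a sector in normal form and
`x ∈ F` there is another ambient Morse presentation `(G̃, κ̃, Oκ̃)` of the same sector (all
clauses of `SectorNormalForm.morse`, same counts) together with an open `Bx ∋ x`, `Bx ⊆ Oκ̃`,
on which `κ̃` is the constant `κ(x)`.*

**Proof.**  In a corner-slice chart `Θ` at `x` put `β = b₂(tangential) · χ₁((u² + v²)/η)`,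
a smooth bump equal to `1` near `Θ x`, supported in a small ball around `Θ x` (extended by
`0` off the chart), and `κ̃ = κ + β (κ(x) - κ)`, `G̃ = G - 2uvβ(κ(x) - κ) = 1 - 2uv κ̃` near `F`.
Along the normal line `s ↦ Θ⁻¹(z + s e₀)` the function `G̃` reads
`1 - 2(z₀ + s) z₁ [k₀ + b χ₁(((z₀ + s)² + z₁²)/η)(κ(x) - k₀)]` (`κ` is constant along the line,
being `ρ`-invariant), whose derivative at `0` is `-2z₁ [A + B]` with `A ≥ min(k₀, κ(x))` and
`|B| ≤ 2 C_χ |κ(x) - k₀|` (`|χ₁'| ≤ C_χ`, and `z₀² ≤ η` wherever `χ₁' ≠ 0`) — negative once the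
ball is so small that `|κ(x) - k₀| ≤ κ(x)/(8(C_χ + 1))` (`hasDerivAt_constKappa_line`).  So
`G̃` has no critical points on `S ∖ F` inside the ball (`fderiv_ne_zero_of_eventuallyEq_line`),
while off the ball `G̃ = G` locally; all clauses of the presentation transfer, the counts
because `G` has no critical points on `S ∩ Oκ ∖ F` either.  `ρ`-invariance of `κ̃` holds on the
open set of points whose retraction avoids the support patch or which are normally close to
`F` inside the chart.

## References

* D. Gay, R. Kirby, *Trisecting 4-manifolds*, Geom. Topol. 20 (2016) 3097–3132, Def. 1 and
  Def. 8. [GayKirby2016]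
* J. Milnor, *Morse theory* (1963), §§2–3. [Milnor1963]
-/

open scoped Manifold ContDiff Topology
open Set Function Filter Metric

noncomputable section

namespace Literature.Topology.FourManifolds

universe u

/-! ### The one-variable derivative along a normal line -/

/-- **The derivative of `G̃` along a normal line.**  For the profile `χ₁` (values in `[0, 1]`,
`= 0` on `[1, ∞)`, `|χ₁'| ≤ C_χ`) and constants with `|κX - k₀| ≤ κX/(8(C_χ + 1))`,
`0 ≤ b ≤ 1`, `c > 0`, `η > 0` (and any `a`), the function
`φ(s) = 1 - 2(a + s) c [k₀ + b χ₁(((a + s)² + c²)/η)(κX - k₀)]` has negative derivative at `0`.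
[folklore] -/
theorem hasDerivAt_constKappa_line {χ₁ : ℝ → ℝ} (hχ₁d : Differentiable ℝ χ₁)
    (hχ₁01 : ∀ s, 0 ≤ χ₁ s ∧ χ₁ s ≤ 1) (hχ₁zero : ∀ s, 1 ≤ s → χ₁ s = 0)
    {Cχ : ℝ} (hCχ : 0 ≤ Cχ) (hχ₁C : ∀ s, |deriv χ₁ s| ≤ Cχ)
    {κX k₀ b a c η : ℝ} (hκX : 0 < κX) (hk : |κX - k₀| ≤ κX / (8 * (Cχ + 1)))
    (hb : 0 ≤ b ∧ b ≤ 1) (hc : 0 < c) (hη : 0 < η) :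
    ∃ φ' : ℝ, φ' < 0 ∧ HasDerivAt
      (fun s : ℝ => 1 - 2 * (a + s) * c * (k₀ + b * χ₁ (((a + s) ^ 2 + c ^ 2) / η) * (κX - k₀))) φ' 0 := by
  -- the derivative of the inner argument and of `ψ s = χ₁ (((a + s)² + c²)/η)`
  have hlin : HasDerivAt (fun s : ℝ => a + s) 1 0 := (hasDerivAt_id 0).const_add a
  have hin : HasDerivAt (fun s : ℝ => ((a + s) * (a + s) + c ^ 2) / η) (2 * a / η) 0 :=
    (((hlin.mul hlin).add_const (c ^ 2)).div_const η).congr_deriv (by ring)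
  have hψ : HasDerivAt (fun s : ℝ => χ₁ (((a + s) * (a + s) + c ^ 2) / η))
      (deriv χ₁ (((a + 0) * (a + 0) + c ^ 2) / η) * (2 * a / η)) 0 :=
    (hχ₁d _).hasDerivAt.comp 0 hin
  set d : ℝ := deriv χ₁ ((a ^ 2 + c ^ 2) / η) with hd
  have hd' : deriv χ₁ (((a + 0) * (a + 0) + c ^ 2) / η) = d := by
    rw [hd]; congr 1; ring
  rw [hd'] at hψ
  -- the whole function
  have hbr : HasDerivAt (fun s : ℝ => k₀ + b * χ₁ (((a + s) * (a + s) + c ^ 2) / η) * (κX - k₀))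
      (b * (d * (2 * a / η)) * (κX - k₀)) 0 := by
    have := ((hψ.const_mul b).mul_const (κX - k₀)).const_add k₀
    exact this.congr_deriv (by ring)
  have hprod := ((hlin.const_mul 2).mul_const c).mul hbr
  have hφ := hprod.const_sub 1
  -- name the pieces of the derivative
  set A : ℝ := k₀ + b * χ₁ ((a ^ 2 + c ^ 2) / η) * (κX - k₀) with hA
  set B : ℝ := a * (b * (d * (2 * a / η)) * (κX - k₀)) with hB
  refine ⟨-(2 * c * (A + B)), ?_, ?_⟩
  · -- ### the sign
    have hk8 : |κX - k₀| ≤ κX / 8 := by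
      refine hk.trans ?_
      rw [div_le_div_iff₀ (by positivity) (by norm_num)]
      nlinarith
    have hk₀ : 7 * κX / 8 ≤ k₀ := by
      have := (abs_sub_le_iff.1 hk8).1; linarith
    -- `A ≥ min(k₀, κX) ≥ 7κX/8`
    set w : ℝ := b * χ₁ ((a ^ 2 + c ^ 2) / η) with hw
    have hw01 : 0 ≤ w ∧ w ≤ 1 := by
      obtain ⟨h0, h1⟩ := hχ₁01 ((a ^ 2 + c ^ 2) / η)
      exact ⟨mul_nonneg hb.1 h0, by nlinarith [hb.1, hb.2]⟩
    have hAeq : A = (1 - w) * k₀ + w * κX := by rw [hA, hw]; ring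
    have hAge : 7 * κX / 8 ≤ A := by
      rw [hAeq]
      nlinarith [hw01.1, hw01.2]
    -- `|B| ≤ 2 Cχ |κX - k₀| ≤ κX / 4`
    have hBeq : B = (2 * a ^ 2 / η) * b * (d * (κX - k₀)) := by rw [hB]; ring
    have hBle : |B| ≤ κX / 4 := by
      by_cases hr : (a ^ 2 + c ^ 2) / η ≤ 1
      · -- here `a² ≤ η`
        have ha2' : a ^ 2 ≤ η := by
          have : (a ^ 2 + c ^ 2) ≤ η := by rwa [div_le_one hη] at hr
          nlinarith
        rw [hBeq, abs_mul, abs_mul, abs_of_nonneg (by positivity : (0:ℝ) ≤ 2 * a ^ 2 / η),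
          abs_of_nonneg hb.1, abs_mul]
        have h2 : 2 * a ^ 2 / η ≤ 2 := by
          rw [div_le_iff₀ hη]; linarith
        have h3 : 2 * a ^ 2 / η * b ≤ 2 := by
          calc 2 * a ^ 2 / η * b ≤ 2 * 1 := mul_le_mul h2 hb.2 hb.1 (by norm_num)
            _ = 2 := by ring
        have h4 : |d| * |κX - k₀| ≤ Cχ * (κX / (8 * (Cχ + 1))) :=
          mul_le_mul (hχ₁C _) hk (abs_nonneg _) hCχ
        calc 2 * a ^ 2 / η * b * (|d| * |κX - k₀|) ≤ 2 * (Cχ * (κX / (8 * (Cχ + 1)))) :=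
              mul_le_mul h3 h4 (by positivity) (by norm_num)
          _ = (Cχ / (Cχ + 1)) * (κX / 4) := by field_simp; ring
          _ ≤ 1 * (κX / 4) := by
              refine mul_le_mul_of_nonneg_right ?_ (by positivity)
              rw [div_le_one (by positivity)]; linarith
          _ = κX / 4 := one_mul _
      · -- here `χ₁' = 0` (locally constant)
        rw [not_le] at hr
        have hd0 : d = 0 := by
          have heq : χ₁ =ᶠ[𝓝 ((a ^ 2 + c ^ 2) / η)] fun _ => 0 := by
            filter_upwards [Ioi_mem_nhds hr] with s hs using hχ₁zero s (le_of_lt hs)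
          rw [hd, heq.deriv_eq, deriv_const]
        rw [hBeq, hd0]
        simp only [zero_mul, mul_zero, abs_zero]
        positivity
    have hBge : -(κX / 4) ≤ B := by have := (abs_le.1 hBle).1; linarith
    have hsum : 0 < A + B := by linarith
    have : 0 < 2 * c * (A + B) := by positivity
    linarith
  · -- ### the derivative
    have hfun : (fun s : ℝ => 1 - 2 * (a + s) * c * (k₀ + b * χ₁ (((a + s) ^ 2 + c ^ 2) / η) * (κX - k₀))) =
        fun x => 1 - ((fun y => 2 * (a + y) * c) * fun s =>
          k₀ + b * χ₁ (((a + s) * (a + s) + c ^ 2) / η) * (κX - k₀)) x := by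
      funext s
      simp only [Pi.mul_apply]
      ring_nf
    rw [hfun]
    refine hφ.congr_deriv ?_
    rw [hA, hB]
    have e1 : (a * a + c ^ 2) / η = (a ^ 2 + c ^ 2) / η := by ring
    simp only [add_zero, mul_one]
    rw [e1]
    ring

/-! ### Norms in the chart -/

/-- `‖z - t‖² = z₀² + z₁² + (z₂ - t₂)² + (z₃ - t₃)²` for a stratum point `t`. [folklore] -/
theorem norm_sub_stratum_sq (z t : EuclideanSpace ℝ (Fin 4)) (ht0 : t 0 = 0) (ht1 : t 1 = 0) :
    ‖z - t‖ ^ 2 = (z 0 ^ 2 + z 1 ^ 2) + ((z 2 - t 2) ^ 2 + (z 3 - t 3) ^ 2) := by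
  rw [EuclideanSpace.norm_sq_eq]
  simp only [Fin.sum_univ_four, Real.norm_eq_abs, sq_abs, PiLp.sub_apply, ht0, ht1, sub_zero]
  ring

/-! ### The theorem -/

section KappaConst

variable {X : Type u} [TopologicalSpace X] [T2Space X]
  [ChartedSpace (EuclideanSpace ℝ (Fin 4)) X] [IsManifold (𝓡 4) ∞ X]
  {S F : Set X} {u v : X → ℝ} {ρ : X → X} {U O : Set X} {c : ℕ → ℕ}

/-- **Making the corner coefficient constant near a point of the central surface.**  For a
sector in normal form and `x ∈ F` there is an ambient Morse presentation `(G̃, κ̃, Oκ̃)` of the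
sector (every clause of `SectorNormalForm.morse`, same counts `c`) and an open `Bx ∋ x`,
`Bx ⊆ Oκ̃`, on which `κ̃` is the constant `κ̃ x`. [cite: GayKirby2016, Def. 1 and Def. 8] -/
theorem SectorNormalForm.exists_morse_const (hfr : NormalFrame F u v ρ U O)
    (hS : SectorNormalForm S F u v ρ U O c) {x : X} (hx : x ∈ F) :
    ∃ (G κ : X → ℝ) (Oκ Bx : Set X), ContMDiff (𝓡 4) 𝓘(ℝ, ℝ) ∞ G ∧
      ContMDiff (𝓡 4) 𝓘(ℝ, ℝ) ∞ κ ∧ IsOpen Oκ ∧ F ⊆ Oκ ∧ Oκ ⊆ O ∧ (∀ y ∈ Oκ, 0 < κ y) ∧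
      (∀ y ∈ Oκ, κ (ρ y) = κ y) ∧ (∀ y ∈ Oκ, G y = 1 - 2 * u y * v y * κ y) ∧
      (∀ p ∈ S, p ∉ interior S → G p = 1) ∧ (∀ p ∈ interior S, G p < 1) ∧
      (∀ p ∈ S, p ∉ interior S → p ∉ F → ¬ IsMCriticalPt (𝓡 4) G p) ∧
      (∀ p ∈ interior S, IsMCriticalPt (𝓡 4) G p → (mhessian (𝓡 4) G p).Nondegenerate) ∧
      (∀ p ∈ S, p ∈ Oκ → p ∉ F → ¬ IsMCriticalPt (𝓡 4) G p) ∧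
      (∀ n, (interior S ∩ criticalSetOfIndex (𝓡 4) G n).ncard = c n) ∧
      IsOpen Bx ∧ x ∈ Bx ∧ Bx ⊆ Oκ ∧ ∀ y ∈ Bx, κ y = κ x := by
  obtain ⟨G, κ, Oκ, hGs, hκs, hOκo, hFOκ, hOκO, hκpos, hκρ, hGform, hb1, hi1, hb2, hi2, hnocrit, hc⟩ :=
    hS.morse
  obtain ⟨C, hxC, hCO⟩ := hS.corner x hx
  -- ### the chart at `x`
  have hxU : x ∈ U := hfr.F_subset_U hx
  obtain ⟨hux, hvx⟩ := (hfr.memF_iff x hxU).1 hx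
  set t : EuclideanSpace ℝ (Fin 4) := C.Θ x with htdef
  have ht0 : t 0 = 0 := by rw [htdef, C.apply_zero x hxC, hux]
  have ht1 : t 1 = 0 := by rw [htdef, C.apply_one x hxC, hvx]
  have htgt : t ∈ C.Θ.target := C.Θ.map_source hxC
  set κX : ℝ := κ x with hκXdef
  have hκX : 0 < κX := hκpos x (hFOκ hx)
  -- a ball in the target over `Oκ`
  set D : Set (EuclideanSpace ℝ (Fin 4)) := C.Θ.target ∩ C.Θ.symm ⁻¹' Oκ with hD
  have hDo : IsOpen D := C.Θ.continuousOn_symm.isOpen_inter_preimage C.Θ.open_target hOκo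
  have htD : t ∈ D := ⟨htgt, by show C.Θ.symm (C.Θ x) ∈ Oκ; rw [C.Θ.left_inv hxC]; exact hFOκ hx⟩
  obtain ⟨δ₀, hδ₀, hballD⟩ := Metric.isOpen_iff.1 hDo t htD
  -- ### the profile and the smallness of `κ - κX`
  obtain ⟨hχ₁s, hχ₁01, hχ₁one, hχ₁zero, Cχ, hCχ, hχ₁C⟩ := cutoffProfile_props
  set χ₁ : ℝ → ℝ := fun s => Real.smoothTransition (2 - 2 * s) with hχ₁def
  have hχ₁d : Differentiable ℝ χ₁ := hχ₁s.differentiable (by simp)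
  have hone : ∀ s : ℝ, s ≤ 1 / 2 → χ₁ s = 1 := fun s hs => hχ₁one s hs
  have hzero' : ∀ s : ℝ, 1 ≤ s → χ₁ s = 0 := fun s hs => hχ₁zero s hs
  have h01' : ∀ s : ℝ, 0 ≤ χ₁ s ∧ χ₁ s ≤ 1 := fun s => hχ₁01 s
  have hC' : ∀ s : ℝ, |deriv χ₁ s| ≤ Cχ := fun s => hχ₁C s
  have hkk : ContinuousAt (fun z => κ (C.Θ.symm z)) t :=
    (hκs.continuous.comp_continuousOn C.Θ.continuousOn_symm).continuousAt (C.Θ.open_target.mem_nhds htgt)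
  have hkkt : κ (C.Θ.symm t) = κX := by rw [htdef, C.Θ.left_inv hxC]
  set tol : ℝ := κX / (8 * (Cχ + 1)) with htol
  have htolpos : 0 < tol := by positivity
  obtain ⟨δ₁', hδ₁', hδ₁'bd⟩ := Metric.continuousAt_iff.1 hkk tol htolpos
  set δ₁ : ℝ := min δ₀ δ₁' with hδ₁def
  have hδ₁ : 0 < δ₁ := lt_min hδ₀ hδ₁'
  have hballδ₁D : ball t δ₁ ⊆ D := (ball_subset_ball (min_le_left _ _)).trans hballD
  have hκbd : ∀ z ∈ ball t δ₁, |κ (C.Θ.symm z) - κX| < tol := by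
    intro z hz
    have := hδ₁'bd (ball_subset_ball (min_le_right _ _) hz)
    rwa [hkkt, Real.dist_eq] at this
  -- radii: `δ = δ₁/2`, `η = δ²`, `ρ₁² = δ² + η < δ₁²`
  set δ : ℝ := δ₁ / 2 with hδdef
  have hδ : 0 < δ := by positivity
  set η : ℝ := δ ^ 2 with hηdef
  have hη : 0 < η := by positivity
  have hsum_lt : δ ^ 2 + η < δ₁ ^ 2 := by
    have h := sq_pos_of_pos hδ₁
    rw [hηdef, hδdef]; nlinarith
  set ρ₁ : ℝ := Real.sqrt (δ ^ 2 + η) with hρ₁def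
  have hρ₁pos : 0 < ρ₁ := Real.sqrt_pos.2 (by positivity)
  have hρ₁sq : ρ₁ ^ 2 = δ ^ 2 + η := Real.sq_sqrt (by positivity)
  have hρ₁lt : ρ₁ < δ₁ := by
    have : ρ₁ ^ 2 < δ₁ ^ 2 := by rw [hρ₁sq]; exact hsum_lt
    exact lt_of_pow_lt_pow_left₀ 2 hδ₁.le this
  have hcballδ₁ : closedBall t ρ₁ ⊆ ball t δ₁ := closedBall_subset_ball hρ₁lt
  -- ### the bump in the chart
  set tang : EuclideanSpace ℝ (Fin 4) → ℝ := fun z => ((z 2 - t 2) ^ 2 + (z 3 - t 3) ^ 2) with htang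
  set nor : EuclideanSpace ℝ (Fin 4) → ℝ := fun z => z 0 ^ 2 + z 1 ^ 2 with hnor
  set βh : EuclideanSpace ℝ (Fin 4) → ℝ := fun z => χ₁ (tang z / δ ^ 2) * χ₁ (nor z / η) with hβh
  have hcoord : ∀ k : Fin 4, ContDiff ℝ ∞ fun z : EuclideanSpace ℝ (Fin 4) => z k := fun k =>
    (EuclideanSpace.proj k : EuclideanSpace ℝ (Fin 4) →L[ℝ] ℝ).contDiff
  have htangs : ContDiff ℝ ∞ tang := by
    show ContDiff ℝ ∞ fun z : EuclideanSpace ℝ (Fin 4) => ((z 2 - t 2) ^ 2 + (z 3 - t 3) ^ 2)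
    exact (((hcoord 2).sub contDiff_const).pow 2).add (((hcoord 3).sub contDiff_const).pow 2)
  have hnors : ContDiff ℝ ∞ nor := by
    show ContDiff ℝ ∞ fun z : EuclideanSpace ℝ (Fin 4) => z 0 ^ 2 + z 1 ^ 2
    exact ((hcoord 0).pow 2).add ((hcoord 1).pow 2)
  have hβhs : ContDiff ℝ ∞ βh :=
    (hχ₁s.comp (htangs.div_const _)).mul (hχ₁s.comp (hnors.div_const _))
  have hβh01 : ∀ z, 0 ≤ βh z ∧ βh z ≤ 1 := fun z =>
    ⟨mul_nonneg (hχ₁01 _).1 (hχ₁01 _).1, mul_le_one₀ (hχ₁01 _).2 (hχ₁01 _).1 (hχ₁01 _).2⟩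
  -- the support of `βh` lies in the open ball of radius `ρ₁`
  have hβhsupp : ∀ z, βh z ≠ 0 → ‖z - t‖ < ρ₁ := by
    intro z hz
    have h1 : χ₁ (tang z / δ ^ 2) ≠ 0 := left_ne_zero_of_mul hz
    have h2 : χ₁ (nor z / η) ≠ 0 := right_ne_zero_of_mul hz
    have h1' : tang z / δ ^ 2 < 1 := by by_contra h; exact h1 (hχ₁zero _ (not_lt.1 h))
    have h2' : nor z / η < 1 := by by_contra h; exact h2 (hχ₁zero _ (not_lt.1 h))
    rw [div_lt_one (by positivity)] at h1' h2'
    have hsq : ‖z - t‖ ^ 2 < ρ₁ ^ 2 := by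
      rw [norm_sub_stratum_sq z t ht0 ht1, hρ₁sq]
      simp only [hnor, htang] at h1' h2'
      linarith
    exact lt_of_pow_lt_pow_left₀ 2 hρ₁pos.le hsq
  -- ### the compact carrier in `X`
  set KX : Set X := C.Θ.symm '' closedBall t ρ₁ with hKX
  have hcbT : closedBall t ρ₁ ⊆ C.Θ.target := fun z hz => (hballδ₁D (hcballδ₁ hz)).1
  have hKXc : IsCompact KX := (isCompact_closedBall t ρ₁).image_of_continuousOn
    (C.Θ.continuousOn_symm.mono hcbT)
  have hKXcl : IsClosed KX := hKXc.isClosed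
  have hKXsrc : KX ⊆ C.Θ.source := by
    rintro _ ⟨z, hz, rfl⟩; exact C.Θ.map_target (hcbT hz)
  have hKXOκ : KX ⊆ Oκ := by
    rintro _ ⟨z, hz, rfl⟩; exact (hballδ₁D (hcballδ₁ hz)).2
  -- ### the bump on `X`
  set β : X → ℝ := C.Θ.source.indicator fun y => βh (C.Θ y) with hβdef
  have hβin : ∀ y ∈ C.Θ.source, β y = βh (C.Θ y) := fun y hy => indicator_of_mem hy _
  have hβout : ∀ y ∉ KX, β y = 0 := by
    intro y hy
    by_cases hysrc : y ∈ C.Θ.source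
    · rw [hβin y hysrc]
      by_contra hne
      apply hy
      refine ⟨C.Θ y, ?_, C.Θ.left_inv hysrc⟩
      exact mem_closedBall.2 (by rw [dist_eq_norm]; exact (hβhsupp _ hne).le)
    · exact indicator_of_notMem hysrc _
  have hβ01 : ∀ y, 0 ≤ β y ∧ β y ≤ 1 := by
    intro y
    by_cases hysrc : y ∈ C.Θ.source
    · rw [hβin y hysrc]; exact hβh01 _
    · rw [hβdef, indicator_of_notMem hysrc]; exact ⟨le_rfl, zero_le_one⟩
  have hβs : ContMDiff (𝓡 4) 𝓘(ℝ, ℝ) ∞ β := by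
    intro y
    by_cases hysrc : y ∈ C.Θ.source
    · have heq : β =ᶠ[𝓝 y] fun y => βh (C.Θ y) := by
        filter_upwards [C.Θ.open_source.mem_nhds hysrc] with w hw using hβin w hw
      refine ContMDiffAt.congr_of_eventuallyEq ?_ heq
      have h1 : ContMDiffAt (𝓡 4) 𝓘(ℝ, EuclideanSpace ℝ (Fin 4)) ∞ C.Θ y :=
        C.contMDiffOn_toFun.contMDiffAt (C.Θ.open_source.mem_nhds hysrc)
      exact ((contMDiff_iff_contDiff.2 hβhs).contMDiffAt).comp y h1
    · have hyK : y ∉ KX := fun h => hysrc (hKXsrc h)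
      have heq : β =ᶠ[𝓝 y] fun _ => 0 := by
        filter_upwards [hKXcl.isOpen_compl.mem_nhds hyK] with w hw using hβout w hw
      exact contMDiffAt_const.congr_of_eventuallyEq heq
  -- ### the new presentation
  set κt : X → ℝ := fun y => κ y + β y * (κX - κ y) with hκt
  set Gt : X → ℝ := fun y => G y - 2 * u y * v y * (β y * (κX - κ y)) with hGt
  have hκts : ContMDiff (𝓡 4) 𝓘(ℝ, ℝ) ∞ κt := hκs.add (hβs.mul (contMDiff_const.sub hκs))
  have hGts : ContMDiff (𝓡 4) 𝓘(ℝ, ℝ) ∞ Gt :=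
    hGs.sub (((contMDiff_const.mul hfr.contMDiff_u).mul hfr.contMDiff_v).mul
      (hβs.mul (contMDiff_const.sub hκs)))
  have hGtform : ∀ y ∈ Oκ, Gt y = 1 - 2 * u y * v y * κt y := by
    intro y hy; simp only [hGt, hκt]; rw [hGform y hy]; ring
  have hκtpos : ∀ y ∈ Oκ, 0 < κt y := by
    intro y hy
    have h1 := hκpos y hy
    obtain ⟨hb0, hb1'⟩ := hβ01 y
    show 0 < κ y + β y * (κX - κ y)
    have hcc : κ y + β y * (κX - κ y) = (1 - β y) * κ y + β y * κX := by ring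
    rw [hcc]
    rcases hb1'.lt_or_eq with hlt | heq
    · nlinarith [mul_pos (sub_pos.2 hlt) h1]
    · rw [heq]; simp only [sub_self, zero_mul, one_mul, zero_add]; exact hκX
  -- `Gt = G` off `KX`, locally
  have hGteq : ∀ y ∉ KX, Gt =ᶠ[𝓝 y] fun w => G w + 0 := by
    intro y hy
    filter_upwards [hKXcl.isOpen_compl.mem_nhds hy] with w hw
    simp only [hGt, hβout w hw, zero_mul, mul_zero, sub_zero, add_zero]
  -- ### the region of `ρ`-invariance
  set KP : Set X := C.Θ.symm '' (closedBall t ρ₁ ∩ {z | z 0 = 0 ∧ z 1 = 0}) with hKP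
  have hKPc : IsCompact KP := by
    refine ((isCompact_closedBall t ρ₁).inter_right ?_).image_of_continuousOn
      (C.Θ.continuousOn_symm.mono (inter_subset_left.trans hcbT))
    exact (isClosed_eq (continuous_apply 0 |>.comp (PiLp.continuous_ofLp 2 _)) continuous_const).inter
      (isClosed_eq (continuous_apply 1 |>.comp (PiLp.continuous_ofLp 2 _)) continuous_const)
  have hKPcl : IsClosed KP := hKPc.isClosed
  set A : Set X := ρ ⁻¹' KPᶜ with hA
  have hAo : IsOpen A := hKPcl.isOpen_compl.preimage hfr.contMDiff_ρ.continuous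
  set Bn : Set X := C.Θ.source ∩ C.Θ ⁻¹' {z | nor z < η / 2} with hBn
  have hBno : IsOpen Bn := C.Θ.continuousOn.isOpen_inter_preimage C.Θ.open_source
    (isOpen_lt hnors.continuous continuous_const)
  set Oκ' : Set X := Oκ ∩ (A ∪ Bn) with hOκ'
  have hOκ'o : IsOpen Oκ' := hOκo.inter (hAo.union hBno)
  have hFOκ' : F ⊆ Oκ' := by
    intro x' hx'
    refine ⟨hFOκ hx', ?_⟩
    by_cases hKP' : x' ∈ KP
    · right
      obtain ⟨z, ⟨hz, hz0, hz1⟩, rfl⟩ := hKP'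
      have hzT : z ∈ C.Θ.target := hcbT hz
      refine ⟨C.Θ.map_target hzT, ?_⟩
      show nor (C.Θ (C.Θ.symm z)) < η / 2
      rw [C.Θ.right_inv hzT]
      simp only [hnor, hz0, hz1]; norm_num; linarith
    · left
      show ρ x' ∈ KPᶜ
      rw [hfr.ρ_eq_self_of_mem hx']; exact hKP'
  have hOκ'Oκ : Oκ' ⊆ Oκ := inter_subset_left
  -- `βh` vanishes at points whose projection avoids `KP`
  have hβh_stratum : ∀ z ∈ C.Θ.target, βh z ≠ 0 → C.Θ.symm (stratumProj z) ∈ KP := by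
    intro z hzT hne
    have h1 : χ₁ (tang z / δ ^ 2) ≠ 0 := left_ne_zero_of_mul hne
    have h1' : tang z / δ ^ 2 < 1 := by by_contra h; exact h1 (hχ₁zero _ (not_lt.1 h))
    rw [div_lt_one (by positivity)] at h1'
    refine ⟨stratumProj z, ⟨?_, rfl, rfl⟩, rfl⟩
    rw [mem_closedBall, dist_eq_norm]
    have hsq : ‖stratumProj z - t‖ ^ 2 ≤ ρ₁ ^ 2 := by
      rw [norm_sub_stratum_sq _ t ht0 ht1, hρ₁sq]
      simp only [stratumProj_apply_zero, stratumProj_apply_one, stratumProj_apply_two,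
        stratumProj_apply_three]
      simp only [htang] at h1'
      nlinarith
    exact le_of_pow_le_pow_left₀ two_ne_zero hρ₁pos.le hsq
  have hκtρ : ∀ y ∈ Oκ', κt (ρ y) = κt y := by
    rintro y ⟨hyOκ, hyAB⟩
    have hκy : κ (ρ y) = κ y := hκρ y hyOκ
    have hyO : y ∈ O := hOκO hyOκ
    suffices hβρ : β (ρ y) = β y by simp only [hκt, hκy, hβρ]
    rcases hyAB with hyA | hyBn
    · -- both vanish
      have hρKP : ρ y ∉ KP := hyA
      have h1 : β (ρ y) = 0 := by
        by_cases hρsrc : ρ y ∈ C.Θ.source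
        · rw [hβin _ hρsrc]
          by_contra hne
          have hρF : ρ y ∈ F := hfr.ρ_mem y hyO
          have hsP : stratumProj (C.Θ (ρ y)) = C.Θ (ρ y) :=
            stratumProj_eq_self ((C.mem_K_iff _ hρsrc).1 hρF |>.1 ▸ C.apply_zero _ hρsrc)
              ((C.mem_K_iff _ hρsrc).1 hρF |>.2 ▸ C.apply_one _ hρsrc)
          have := hβh_stratum _ (C.Θ.map_source hρsrc) hne
          rw [hsP, C.Θ.left_inv hρsrc] at this
          exact hρKP this
        · exact indicator_of_notMem hρsrc _
      have h2 : β y = 0 := by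
        by_cases hysrc : y ∈ C.Θ.source
        · rw [hβin _ hysrc]
          by_contra hne
          have := hβh_stratum _ (C.Θ.map_source hysrc) hne
          rw [← C.π_symm_eq (C.Θ.map_source hysrc), C.Θ.left_inv hysrc] at this
          exact hρKP this
        · exact indicator_of_notMem hysrc _
      rw [h1, h2]
    · -- inside the chart, normally close to `F`
      obtain ⟨hysrc, hynor⟩ := hyBn
      have hynor' : nor (C.Θ y) < η / 2 := hynor
      have hρsrc : ρ y ∈ C.Θ.source := C.mapsTo_π hysrc
      rw [hβin _ hρsrc, hβin _ hysrc, C.apply_π y hysrc]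
      simp only [hβh, htang, hnor, stratumProj_apply_zero, stratumProj_apply_one, stratumProj_apply_two,
        stratumProj_apply_three]
      have h0 : ((0:ℝ) ^ 2 + 0 ^ 2) / η = 0 := by simp
      rw [h0, hone 0 (by norm_num), hone (((C.Θ y) 0 ^ 2 + (C.Θ y) 1 ^ 2) / η) ?_]
      rw [div_le_iff₀ hη]; simp only [hnor] at hynor'; linarith
  -- ### the constant region `Bx`
  set Bx : Set X := C.Θ.source ∩ C.Θ ⁻¹' {z | tang z < δ ^ 2 / 2 ∧ nor z < η / 2} with hBx
  have hBxo : IsOpen Bx := C.Θ.continuousOn.isOpen_inter_preimage C.Θ.open_source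
    ((isOpen_lt htangs.continuous continuous_const).inter (isOpen_lt hnors.continuous continuous_const))
  have hxBx : x ∈ Bx := by
    refine ⟨hxC, ?_⟩
    show tang (C.Θ x) < δ ^ 2 / 2 ∧ nor (C.Θ x) < η / 2
    rw [← htdef]
    simp only [htang, hnor, ht0, ht1, sub_self]
    norm_num
    exact ⟨by positivity, by positivity⟩
  have hBx_ball : ∀ y ∈ Bx, ‖C.Θ y - t‖ < ρ₁ := by
    rintro y ⟨hysrc, htg, hnr⟩
    have hsq : ‖C.Θ y - t‖ ^ 2 < ρ₁ ^ 2 := by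
      rw [norm_sub_stratum_sq _ t ht0 ht1, hρ₁sq]
      simp only [htang, hnor] at htg hnr
      linarith
    exact lt_of_pow_lt_pow_left₀ 2 hρ₁pos.le hsq
  have hBxOκ' : Bx ⊆ Oκ' := by
    intro y hy
    obtain ⟨hysrc, htg, hnr⟩ := hy
    refine ⟨?_, Or.inr ⟨hysrc, hnr⟩⟩
    have : C.Θ y ∈ ball t δ₁ := by
      rw [mem_ball, dist_eq_norm]; exact (hBx_ball y ⟨hysrc, htg, hnr⟩).trans hρ₁lt
    have h := (hballδ₁D this).2
    rwa [mem_preimage, C.Θ.left_inv hysrc] at h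
  have hBxconst : ∀ y ∈ Bx, κt y = κt x := by
    have hβ1 : ∀ y ∈ Bx, β y = 1 := by
      rintro y ⟨hysrc, htg, hnr⟩
      rw [hβin _ hysrc]
      simp only [hβh]
      rw [hone _ ?_, hone _ ?_, one_mul]
      · rw [div_le_iff₀ hη]; simp only [hnor] at hnr ⊢; linarith
      · rw [div_le_iff₀ (by positivity)]; simp only [htang] at htg ⊢; linarith
    intro y hy
    simp only [hκt, hβ1 y hy, hβ1 x hxBx, one_mul]
    ring
  -- ### points of `KX`: in the source, over the ball `B(t, δ₁)`, in `Oκ`, in `U`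
  have hsrcU : C.Θ.source ⊆ U := hCO.trans hfr.O_subset_U
  have hKXfacts : ∀ p ∈ KX, p ∈ C.Θ.source ∧ C.Θ p ∈ ball t δ₁ := by
    rintro _ ⟨z, hz, rfl⟩
    exact ⟨C.Θ.map_target (hcbT hz), by rw [C.Θ.right_inv (hcbT hz)]; exact hcballδ₁ hz⟩
  -- ### `κ` is constant along the normal directions in the chart
  have hκline : ∀ w ∈ ball t δ₁, κ (C.Θ.symm w) = κ (C.Θ.symm (stratumProj w)) := by
    intro w hw
    have hwD := hballδ₁D hw
    rw [← C.π_symm_eq hwD.1, hκρ _ hwD.2]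
  -- ### the formula for `Gt` in the chart over the ball
  have hformula : ∀ w ∈ ball t δ₁, Gt (C.Θ.symm w) =
      1 - 2 * w 0 * w 1 * (κ (C.Θ.symm (stratumProj w)) + βh w * (κX - κ (C.Θ.symm (stratumProj w)))) := by
    intro w hw
    have hwD := hballδ₁D hw
    have hwsrc : C.Θ.symm w ∈ C.Θ.source := C.Θ.map_target hwD.1
    rw [hGtform _ hwD.2]
    have hu' : u (C.Θ.symm w) = w 0 := by rw [← C.apply_zero _ hwsrc, C.Θ.right_inv hwD.1]
    have hv' : v (C.Θ.symm w) = w 1 := by rw [← C.apply_one _ hwsrc, C.Θ.right_inv hwD.1]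
    have hβ' : β (C.Θ.symm w) = βh w := by rw [hβin _ hwsrc, C.Θ.right_inv hwD.1]
    simp only [hκt, hu', hv', hβ', hκline w hw]
  -- ### `Gt` has no critical points on `S ∖ F` over the ball
  have hnear : ∀ y ∈ S, y ∈ C.Θ.source → C.Θ y ∈ ball t δ₁ → y ∉ F → ¬ IsMCriticalPt (𝓡 4) Gt y := by
    intro y hyS hysrc hyball hyF
    have hyU : y ∈ U := hsrcU hysrc
    set z : EuclideanSpace ℝ (Fin 4) := C.Θ y with hz
    have hz0 : z 0 = u y := C.apply_zero y hysrc
    have hz1 : z 1 = v y := C.apply_one y hysrc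
    have hzT : z ∈ C.Θ.target := C.Θ.map_source hysrc
    obtain ⟨hu0, hv0⟩ := (hS.mem_iff y hyU).1 hyS
    have hne : ¬ (u y = 0 ∧ v y = 0) := fun h => hyF ((hfr.memF_iff y hyU).2 h)
    -- `Gt` read in the chart
    set Gh : EuclideanSpace ℝ (Fin 4) → ℝ := Gt ∘ C.Θ.symm with hGh
    have hGhd : DifferentiableAt ℝ Gh z := by
      have h1 : ContMDiffOn 𝓘(ℝ, EuclideanSpace ℝ (Fin 4)) 𝓘(ℝ, ℝ) ∞ Gh C.Θ.target :=
        hGts.comp_contMDiffOn C.contMDiffOn_symm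
      exact ((contMDiffOn_iff_contDiffOn.mp h1).contDiffAt (C.Θ.open_target.mem_nhds hzT)).differentiableAt
        (by simp)
    have hmem2 : C.Θ ∈ IsManifold.maximalAtlas (𝓡 4) 2 X :=
      IsManifold.maximalAtlas_subset_of_le (M := X) (I := 𝓡 4) ENat.LEInfty.out C.Θ_mem_maximalAtlas
    have hcrit_iff : IsMCriticalPt (𝓡 4) Gt y ↔ fderiv ℝ Gh z = 0 := by
      rw [isMCriticalPt_iff_fderiv_comp_extend_symm_eq_zero (I := 𝓡 4)
        ((hGts.contMDiffAt (x := y)).of_le ENat.LEInfty.out) hmem2 hysrc]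
      have h1 : (Gt ∘ (C.Θ.extend (𝓡 4)).symm) = Gh := by ext w; simp [hGh]
      have h2 : C.Θ.extend (𝓡 4) y = z := by simp [hz]
      rw [h1, h2]
    rw [hcrit_iff]
    -- the constant `k₀` and its distance to `κX`
    set k₀ : ℝ := κ (C.Θ.symm (stratumProj z)) with hk₀
    have hk₀bd : |κX - k₀| ≤ tol := by
      have hsPball : stratumProj z ∈ ball t δ₁ := by
        rw [mem_ball, dist_eq_norm] at hyball ⊢
        exact (norm_stratumProj_sub_le ht0 ht1).trans_lt hyball
      have := hκbd _ hsPball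
      rw [abs_sub_comm]; exact this.le
    -- points of the lines stay in the ball
    have hballnear : ∀ e : EuclideanSpace ℝ (Fin 4), ∀ᶠ s in 𝓝[≥] (0:ℝ), z + s • e ∈ ball t δ₁ := by
      intro e
      have hcont : Continuous fun s : ℝ => z + s • e := by fun_prop
      have hlim : Tendsto (fun s : ℝ => z + s • e) (𝓝 0) (𝓝 z) := by simpa using hcont.tendsto 0
      exact (hlim.eventually (isOpen_ball.mem_nhds hyball)).filter_mono nhdsWithin_le_nhds
    by_cases hv : 0 < v y
    · -- ### move in the `u`-direction
      set e0 : EuclideanSpace ℝ (Fin 4) := EuclideanSpace.single 0 (1:ℝ) with he0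
      have ha : ∀ s : ℝ, (z + s • e0) 0 = z 0 + s := fun s => by simp [he0]
      have hb : ∀ s : ℝ, (z + s • e0) 1 = z 1 := fun s => by simp [he0]
      have h2 : ∀ s : ℝ, (z + s • e0) 2 = z 2 := fun s => by simp [he0]
      have h3 : ∀ s : ℝ, (z + s • e0) 3 = z 3 := fun s => by simp [he0]
      have hsP : ∀ s : ℝ, stratumProj (z + s • e0) = stratumProj z := fun s => by
        ext i; fin_cases i <;> simp [stratumProj, he0]
      obtain ⟨φ', hφ'neg, hφ'⟩ := hasDerivAt_constKappa_line (a := z 0) (c := z 1) (k₀ := k₀)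
        hχ₁d h01' hzero' hCχ hC' hκX hk₀bd (h01' (tang z / δ ^ 2)) (by rw [hz1]; exact hv) hη
      have heq : ∀ᶠ s in 𝓝[≥] (0:ℝ), Gh (z + s • e0) =
          1 - 2 * (z 0 + s) * z 1 * (k₀ + χ₁ (tang z / δ ^ 2) * χ₁ (((z 0 + s) ^ 2 + z 1 ^ 2) / η) * (κX - k₀)) := by
        filter_upwards [hballnear e0] with s hs
        show Gt (C.Θ.symm (z + s • e0)) = _
        rw [hformula _ hs, hsP, ← hk₀, ha, hb]
        simp only [hβh, htang, hnor, h2, h3, ha, hb]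
      exact fderiv_ne_zero_of_eventuallyEq_line hGhd hφ' hφ'neg.ne heq
    · -- ### `v y = 0`, so `u y > 0`: move in the `v`-direction
      have hv0' : v y = 0 := le_antisymm (not_lt.1 hv) hv0
      have hu : 0 < u y := lt_of_le_of_ne hu0 fun h0 => hne ⟨h0.symm, hv0'⟩
      set e1 : EuclideanSpace ℝ (Fin 4) := EuclideanSpace.single 1 (1:ℝ) with he1
      have ha : ∀ s : ℝ, (z + s • e1) 1 = z 1 + s := fun s => by simp [he1]
      have hb : ∀ s : ℝ, (z + s • e1) 0 = z 0 := fun s => by simp [he1]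
      have h2 : ∀ s : ℝ, (z + s • e1) 2 = z 2 := fun s => by simp [he1]
      have h3 : ∀ s : ℝ, (z + s • e1) 3 = z 3 := fun s => by simp [he1]
      have hsP : ∀ s : ℝ, stratumProj (z + s • e1) = stratumProj z := fun s => by
        ext i; fin_cases i <;> simp [stratumProj, he1]
      obtain ⟨φ', hφ'neg, hφ'⟩ := hasDerivAt_constKappa_line (a := z 1) (c := z 0) (k₀ := k₀)
        hχ₁d h01' hzero' hCχ hC' hκX hk₀bd (h01' (tang z / δ ^ 2)) (by rw [hz0]; exact hu) hη
      have heq : ∀ᶠ s in 𝓝[≥] (0:ℝ), Gh (z + s • e1) =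
          1 - 2 * (z 1 + s) * z 0 * (k₀ + χ₁ (tang z / δ ^ 2) * χ₁ (((z 1 + s) ^ 2 + z 0 ^ 2) / η) * (κX - k₀)) := by
        filter_upwards [hballnear e1] with s hs
        show Gt (C.Θ.symm (z + s • e1)) = _
        rw [hformula _ hs, hsP, ← hk₀, ha, hb]
        simp only [hβh, htang, hnor, h2, h3, ha, hb]
        ring_nf
      exact fderiv_ne_zero_of_eventuallyEq_line hGhd hφ' hφ'neg.ne heq
  -- ### the clauses of the presentation
  have hb1' : ∀ p ∈ S, p ∉ interior S → Gt p = 1 := by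
    intro p hpS hnot
    by_cases hpU : p ∈ U
    · have huv : u p = 0 ∨ v p = 0 := (hS.not_mem_interior_iff hpU hpS).1 hnot
      show G p - 2 * u p * v p * (β p * (κX - κ p)) = 1
      rw [hb1 p hpS hnot]
      rcases huv with h | h <;> simp [h]
    · have hpK : p ∉ KX := fun h => hpU (hsrcU (hKXsrc h))
      show G p - 2 * u p * v p * (β p * (κX - κ p)) = 1
      rw [hβout p hpK, hb1 p hpS hnot]; ring
  have hi1' : ∀ p ∈ interior S, Gt p < 1 := by
    intro p hint
    by_cases hβ0 : β p = 0
    · show G p - 2 * u p * v p * (β p * (κX - κ p)) < 1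
      rw [hβ0]; simpa using hi1 p hint
    · have hpK : p ∈ KX := by by_contra h; exact hβ0 (hβout p h)
      have hpOκ : p ∈ Oκ := hKXOκ hpK
      have hpU : p ∈ U := hsrcU (hKXsrc hpK)
      rw [hGtform p hpOκ]
      obtain ⟨hu', hv'⟩ := (hS.interior_iff p hpU (interior_subset hint)).1 hint
      have hκ' := hκtpos p hpOκ
      nlinarith [mul_pos (mul_pos hu' hv') hκ']
  have hb2' : ∀ p ∈ S, p ∉ interior S → p ∉ F → ¬ IsMCriticalPt (𝓡 4) Gt p := by
    intro p hpS hnot hpF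
    by_cases hpK : p ∈ KX
    · obtain ⟨hpsrc, hpball⟩ := hKXfacts p hpK
      exact hnear p hpS hpsrc hpball hpF
    · rw [isMCriticalPt_congr_of_eventuallyEq_add_const (hGteq p hpK)]
      exact hb2 p hpS hnot hpF
  have hi2' : ∀ p ∈ interior S, IsMCriticalPt (𝓡 4) Gt p → (mhessian (𝓡 4) Gt p).Nondegenerate := by
    intro p hint hcrit
    have hpK : p ∉ KX := by
      intro hpK
      obtain ⟨hpsrc, hpball⟩ := hKXfacts p hpK
      exact hnear p (interior_subset hint) hpsrc hpball
        (fun hpF => hS.not_mem_interior_of_mem_F hpF hint) hcrit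
    rw [mhessian_congr_of_eventuallyEq_add_const (hGteq p hpK)]
    rw [isMCriticalPt_congr_of_eventuallyEq_add_const (hGteq p hpK)] at hcrit
    exact hi2 p hint hcrit
  have hnocrit' : ∀ p ∈ S, p ∈ Oκ' → p ∉ F → ¬ IsMCriticalPt (𝓡 4) Gt p := by
    intro p hpS hpO hpF
    by_cases hpK : p ∈ KX
    · obtain ⟨hpsrc, hpball⟩ := hKXfacts p hpK
      exact hnear p hpS hpsrc hpball hpF
    · rw [isMCriticalPt_congr_of_eventuallyEq_add_const (hGteq p hpK)]
      exact hnocrit p hpS (hOκ'Oκ hpO) hpF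
  have hc' : ∀ n, (interior S ∩ criticalSetOfIndex (𝓡 4) Gt n).ncard = c n := by
    intro n
    have hset : interior S ∩ criticalSetOfIndex (𝓡 4) Gt n = interior S ∩ criticalSetOfIndex (𝓡 4) G n := by
      ext p
      simp only [mem_inter_iff, mem_criticalSetOfIndex]
      constructor
      · rintro ⟨hint, hcrit, hidx⟩
        have hpK : p ∉ KX := by
          intro hpK
          obtain ⟨hpsrc, hpball⟩ := hKXfacts p hpK
          exact hnear p (interior_subset hint) hpsrc hpball
            (fun hpF => hS.not_mem_interior_of_mem_F hpF hint) hcrit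
        refine ⟨hint, ?_, ?_⟩
        · rwa [isMCriticalPt_congr_of_eventuallyEq_add_const (hGteq p hpK)] at hcrit
        · unfold morseIndex at hidx ⊢
          rwa [mhessian_congr_of_eventuallyEq_add_const (hGteq p hpK)] at hidx
      · rintro ⟨hint, hcrit, hidx⟩
        have hpK : p ∉ KX := by
          intro hpK
          exact hnocrit p (interior_subset hint) (hKXOκ hpK)
            (fun hpF => hS.not_mem_interior_of_mem_F hpF hint) hcrit
        refine ⟨hint, ?_, ?_⟩
        · rwa [isMCriticalPt_congr_of_eventuallyEq_add_const (hGteq p hpK)]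
        · unfold morseIndex at hidx ⊢
          rwa [mhessian_congr_of_eventuallyEq_add_const (hGteq p hpK)]
    rw [hset, hc n]
  exact ⟨Gt, κt, Oκ', Bx, hGts, hκts, hOκ'o, hFOκ', hOκ'Oκ.trans hOκO, fun y hy => hκtpos y (hOκ'Oκ hy),
    hκtρ, fun y hy => hGtform y (hOκ'Oκ hy), hb1', hi1', hb2', hi2', hnocrit', hc', hBxo, hxBx, hBxOκ',
    hBxconst⟩

end KappaConst

end Literature.Topology.FourManifolds
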